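import Summits.QuantumFields.QCD.Theorems.NestedDissectionSeaNegativeCellsDiluteOfPinnedStripLaw
import Summits.QuantumFields.QCD.Theorems.NestedDissectionSeaNegativeCellsDiluteStubSignMobility
import Summits.QuantumFields.QCD.Theorems.NestedDissectionSeaNegativeCellsDiluteStubConcentration
import Summits.QuantumFields.QCD.Theorems.NestedDissectionSeaNegativeCellsDiluteStubPinOfFloor
import Literature.MathematicalPhysics.QuantumFieldTheory.QCDPhaseQuenched

/-!
# `NegativeCellsDilute` from the tuned strip witness — the certified reduction of line `mass-wegner-cell-index` with
# the `sign-mobility-identity` graft on the parity pin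
(crux `Summit.QuantumFields.QCD.Theses.NestedDissectionSea.NegativeCellsDilute`, item stmt-QuantumFields-13900,
route route-QuantumFields-NestedDissectionSea; lead prover-line-stmt-QuantumFields-13900-0, 2026-08-16)

The companion file `…NegativeCellsDiluteOfPinnedStripLaw` certifies `C⁺ → NegativeCellsDilute` for the transfer
`C⁺` = (a⁺) WINDOWED STRIP LAW ∧ (b) PARITY PIN under one regularisation. This file removes the parity clause from the
hypothesis: by the three landed stubs of the crux idea `sign-mobility-identity`,

* `stub_signMobility` — heat-bath orthogonality `∫ σ · m_B d(pq) = 0` for the flip propensity `m_B` of every finite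
  link set `B` (measurable, `[0,1]`-valued),
* `stub_concentration` — second-moment concentration: `±1` observable orthogonal to `K` propensities with means `≥ p₀`
  and relative covariances `≤ θ`, `1/(K p₀) + θ ≤ 1/4` ⇒ `P(σ = −1) ≥ 1/4`,
* `stub_pinOfFloor` — BLOCK FLOOR ∧ RATIO MIXING ⇒ the crux's pin on all odd tori of physical side `≥ R₀`,

the pin (b) follows from a k-uniform BLOCK FLOOR (`⟨m_b⟩₊ ≥ p₀` for every link block of physical side `L_b`) and
RATIO MIXING (`Cov₊(m_b, m_b′) ≤ θ ⟨m_b⟩₊⟨m_b′⟩₊` for blocks `d₀` apart, `θ ≤ 1/8`) under the same `reg`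
(`pinnedStripLaw_of_tunedStripWitness`), hence (`negativeCellsDilute_of_tunedStripWitness`) the crux follows from the
TUNED STRIP WITNESS: ONE admissible regularisation carrying (a⁺) ∧ floor ∧ mixing — three ONE-SIDED estimates (an
upper bound on a linear spectral statistic of Dirichlet Wilson cells, a lower bound on a conditional flip propensity,
a relative covariance bound), with no parity / `≥ 1/4` clause left. That witness statement (the line's open stub
`stub_tunedStripWitness`) is open physics and is NOT asserted here; it is the hypothesis. Pure theorem file, no
definitions, standard axioms.
-/

noncomputable section

namespace Summit.QuantumFields.QCD.Cruxes.NegativeCellsDilute.MassWegnerCellIndex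

open scoped BigOperators ENNReal Classical
open MeasureTheory Filter
open Literature.MathematicalPhysics.QuantumLattice Literature.MathematicalPhysics.QuantumFieldTheory
  Literature.Probability.LatticeModels
open Summit.QuantumFields.QCD.Theses.NestedDissectionSea (NegativeCellsDilute)

/-- **Floor ∧ mixing replace the pin inside the transfer.** The tuned strip witness (hypothesis `h₄`: one admissible
`reg` with the windowed strip law (a⁺), the block floor and the ratio mixing) yields the planner's transfer `C⁺` —
(a⁺) together with the crux's parity pin (b), verbatim, under the SAME `reg`: `stub_pinOfFloor` (fed
`stub_signMobility`, `stub_concentration`) turns floor + mixing into the pin on all tori of physical side `≥ R₀`;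
answer with `max R R₀` ((a⁺) is monotone in the size threshold). -/
theorem pinnedStripLaw_of_tunedStripWitness
    (h₄ : ∀ Nf : ℕ, (Nf = 2 ∨ Nf = 3) → ∃ reg : QCDRegularisation Nf, reg.HasMassScaling ∧
        (reg.scheme 0 0 0).HasAsymptoticScaling ∧ ∃ M₀ : ℝ, 0 ≤ M₀ ∧ ∃ b₀ : ℕ, 2 ≤ b₀ ∧ ∃ ℓ : ℝ, 0 < ℓ ∧
        ∀ m : Fin Nf → ℝ, (∀ f, M₀ < m f) → ∃ R : ℝ, 0 < R ∧
        ∃ Lb d₀ p₀ θ : ℝ, 0 < Lb ∧ 0 < d₀ ∧ 0 < p₀ ∧ 0 ≤ θ ∧ θ ≤ 1 / 8 ∧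
        (∀ ε : ℝ, 0 < ε → ∀ᶠ k : ℕ in Filter.atTop, ∀ S : ℕ, R ≤ reg.a k * (2 * S + 1) →
          ∃ η : ℝ, 0 < η ∧ ∃ δ : ℕ → ℝ, (∀ j, 0 ≤ δ j) ∧
            ∑ j ∈ Finset.range (Nat.log 2 (⌊ℓ / reg.a k⌋₊ / b₀) + 1), δ j ≤ ε ∧
            ∀ j < Nat.log 2 (⌊ℓ / reg.a k⌋₊ / b₀) + 1, ∀ s : Fin 4 → ℕ,
              (∀ i, b₀ * 2 ^ j ≤ s i ∧ s i < b₀ * 2 ^ (j + 2) ∧ s i ≤ 2 * S + 1 ∧ (s i : ℝ) * reg.a k ≤ ℓ) →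
              η⁻¹ * ∑ f, (∫⁻ μ' in Set.Icc (reg.mcrit k + reg.a k * m f / reg.Zm k) (η - ∑ i, (1 - Real.cos (Real.pi / s i))),
                ENNReal.ofReal
                  ((∫ U : GaugeConfig 4 (2 * S + 1) (Matrix.specialUnitaryGroup (Fin 3) ℂ), (if ((∃ v : {p // wilsonBox (0 : TorusSite 4 (2 * S + 1)) s p} → ℂ, v ≠ 0 ∧
                        ∑ p, ‖(wilsonCell U μ' 0 s).mulVec v p‖ ^ 2 < η ^ 2 * ∑ p, ‖v p‖ ^ 2) ∨
                      ∃ c : Fin 4 → Bool, ∃ v : {p // wilsonBox (halfCorner s c : TorusSite 4 (2 * S + 1)) (halfSides s c) p} → ℂ,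
                        v ≠ 0 ∧ ∑ p, ‖(wilsonCell U μ' (halfCorner s c) (halfSides s c)).mulVec v p‖ ^ 2 <
                          η ^ 2 * ∑ p, ‖v p‖ ^ 2) then (1 : ℝ) else 0) *
                        ∏ f, ‖fermionDet (wilsonDirac (fundamentalRep (Fin 3)) U (reg.mcrit k + reg.a k * m f / reg.Zm k) 1)‖ ∂(wilsonMeasure (fundamentalRep (Fin 3)) (reg.β k))) /
                    (∫ U : GaugeConfig 4 (2 * S + 1) (Matrix.specialUnitaryGroup (Fin 3) ℂ),
                        ∏ f, ‖fermionDet (wilsonDirac (fundamentalRep (Fin 3)) U (reg.mcrit k + reg.a k * m f / reg.Zm k) 1)‖ ∂(wilsonMeasure (fundamentalRep (Fin 3)) (reg.β k))))).toReal ≤ δ j) ∧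
        (∀ M : ℝ, M₀ < M → ∀ᶠ k : ℕ in Filter.atTop, ∀ S : ℕ, R ≤ reg.a k * (2 * S + 1) →
          let N : ℕ := 2 * S + 1
          let mq : Fin Nf → ℝ := fun f => reg.mcrit k + reg.a k * m f / reg.Zm k
          let μp : ℝ := reg.mcrit k - reg.a k * M / reg.Zm k
          let n : ℕ := ⌈Lb / reg.a k⌉₊
          let g : ℕ := ⌈d₀ / reg.a k⌉₊
          let σ : GaugeConfig 4 N SU3 → ℝ := fun U =>
            if (fermionDet (wilsonDirac (fundamentalRep (Fin 3)) U μp 1)).re < 0 then -1 else 1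
          let w : GaugeConfig 4 N SU3 → ℝ := fun U =>
            Real.exp (-(reg.β k * wilsonAction (fundamentalRep (Fin 3)) U)) *
              ∏ f, ‖fermionDet (wilsonDirac (fundamentalRep (Fin 3)) U (mq f) 1)‖
          let blk : TorusSite 4 N → Finset (Edge 4 N) := fun x =>
            Finset.univ.filter fun e => ∀ i, (e.1 i - x i).val < n
          let r : Finset (Edge 4 N) → GaugeConfig 4 N SU3 → GaugeConfig 4 N SU3 → GaugeConfig 4 N SU3 :=
            fun B U V e => if e ∈ B then V e else U e
          let mb : TorusSite 4 N → GaugeConfig 4 N SU3 → ℝ := fun x U =>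
            (∫ V, (if σ (r (blk x) U V) ≠ σ U then (1 : ℝ) else 0) * w (r (blk x) U V)
                ∂(Measure.pi fun _ : Edge 4 N => haarProbability SU3)) /
              (∫ V, w (r (blk x) U V) ∂(Measure.pi fun _ : Edge 4 N => haarProbability SU3))
          (∀ x : TorusSite 4 N, p₀ ≤ qcdPhaseQuenchedExpect (reg.β k) N mq (mb x)) ∧
          (∀ x x' : TorusSite 4 N,
            (∃ i : Fin 4, ∀ t t' : ℕ, t < n → t' < n →
              g ≤ ((x i + (t : ZMod N)) - (x' i + (t' : ZMod N))).val ∧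
                g ≤ ((x' i + (t' : ZMod N)) - (x i + (t : ZMod N))).val) →
            qcdPhaseQuenchedExpect (reg.β k) N mq (fun U => mb x U * mb x' U) -
                qcdPhaseQuenchedExpect (reg.β k) N mq (mb x) * qcdPhaseQuenchedExpect (reg.β k) N mq (mb x') ≤
              θ * (qcdPhaseQuenchedExpect (reg.β k) N mq (mb x) *
                qcdPhaseQuenchedExpect (reg.β k) N mq (mb x'))))) :
    ∀ Nf : ℕ, (Nf = 2 ∨ Nf = 3) → ∃ reg : QCDRegularisation Nf, reg.HasMassScaling ∧
        (reg.scheme 0 0 0).HasAsymptoticScaling ∧ ∃ M₀ : ℝ, 0 ≤ M₀ ∧ ∃ b₀ : ℕ, 2 ≤ b₀ ∧ ∃ ℓ : ℝ, 0 < ℓ ∧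
        ∀ m : Fin Nf → ℝ, (∀ f, M₀ < m f) → ∃ R : ℝ, 0 < R ∧
        (∀ ε : ℝ, 0 < ε → ∀ᶠ k : ℕ in Filter.atTop, ∀ S : ℕ, R ≤ reg.a k * (2 * S + 1) →
          ∃ η : ℝ, 0 < η ∧ ∃ δ : ℕ → ℝ, (∀ j, 0 ≤ δ j) ∧
            ∑ j ∈ Finset.range (Nat.log 2 (⌊ℓ / reg.a k⌋₊ / b₀) + 1), δ j ≤ ε ∧
            ∀ j < Nat.log 2 (⌊ℓ / reg.a k⌋₊ / b₀) + 1, ∀ s : Fin 4 → ℕ,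
              (∀ i, b₀ * 2 ^ j ≤ s i ∧ s i < b₀ * 2 ^ (j + 2) ∧ s i ≤ 2 * S + 1 ∧ (s i : ℝ) * reg.a k ≤ ℓ) →
              η⁻¹ * ∑ f, (∫⁻ μ' in Set.Icc (reg.mcrit k + reg.a k * m f / reg.Zm k) (η - ∑ i, (1 - Real.cos (Real.pi / s i))),
                ENNReal.ofReal
                  ((∫ U : GaugeConfig 4 (2 * S + 1) (Matrix.specialUnitaryGroup (Fin 3) ℂ), (if ((∃ v : {p // wilsonBox (0 : TorusSite 4 (2 * S + 1)) s p} → ℂ, v ≠ 0 ∧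
                        ∑ p, ‖(wilsonCell U μ' 0 s).mulVec v p‖ ^ 2 < η ^ 2 * ∑ p, ‖v p‖ ^ 2) ∨
                      ∃ c : Fin 4 → Bool, ∃ v : {p // wilsonBox (halfCorner s c : TorusSite 4 (2 * S + 1)) (halfSides s c) p} → ℂ,
                        v ≠ 0 ∧ ∑ p, ‖(wilsonCell U μ' (halfCorner s c) (halfSides s c)).mulVec v p‖ ^ 2 <
                          η ^ 2 * ∑ p, ‖v p‖ ^ 2) then (1 : ℝ) else 0) *
                        ∏ f, ‖fermionDet (wilsonDirac (fundamentalRep (Fin 3)) U (reg.mcrit k + reg.a k * m f / reg.Zm k) 1)‖ ∂(wilsonMeasure (fundamentalRep (Fin 3)) (reg.β k))) /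
                    (∫ U : GaugeConfig 4 (2 * S + 1) (Matrix.specialUnitaryGroup (Fin 3) ℂ),
                        ∏ f, ‖fermionDet (wilsonDirac (fundamentalRep (Fin 3)) U (reg.mcrit k + reg.a k * m f / reg.Zm k) 1)‖ ∂(wilsonMeasure (fundamentalRep (Fin 3)) (reg.β k))))).toReal ≤ δ j) ∧
        (∀ M : ℝ, M₀ < M → ∀ᶠ k : ℕ in Filter.atTop, ∀ S : ℕ, R ≤ reg.a k * (2 * S + 1) →
          (1 / 4 : ℝ) ≤
            (∫ U : GaugeConfig 4 (2 * S + 1) (Matrix.specialUnitaryGroup (Fin 3) ℂ), (if (fermionDet (wilsonDirac (fundamentalRep (Fin 3)) U (reg.mcrit k - reg.a k * M / reg.Zm k) 1)).re < 0 then (1 : ℝ) else 0) *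
                  ∏ f, ‖fermionDet (wilsonDirac (fundamentalRep (Fin 3)) U (reg.mcrit k + reg.a k * m f / reg.Zm k) 1)‖ ∂(wilsonMeasure (fundamentalRep (Fin 3)) (reg.β k))) /
              (∫ U : GaugeConfig 4 (2 * S + 1) (Matrix.specialUnitaryGroup (Fin 3) ℂ),
                  ∏ f, ‖fermionDet (wilsonDirac (fundamentalRep (Fin 3)) U (reg.mcrit k + reg.a k * m f / reg.Zm k) 1)‖ ∂(wilsonMeasure (fundamentalRep (Fin 3)) (reg.β k)))) := by
  have h₁ := stub_signMobility
  have h₂ := stub_concentration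
  have h₃ := stub_pinOfFloor
  intro Nf hNf
  obtain ⟨reg, hms, has, M₀, hM₀, b₀, hb₀, ℓ, hℓ, hm⟩ := h₄ Nf hNf
  refine ⟨reg, hms, has, M₀, hM₀, b₀, hb₀, ℓ, hℓ, fun m hmM => ?_⟩
  obtain ⟨R, hR, Lb, d₀, p₀, θ, hLb, hd₀, hp₀, hθ, hθ8, hA, hFM⟩ := hm m hmM
  obtain ⟨R₀, hR₀, hpin⟩ := h₃ h₁ h₂ Nf reg M₀ m Lb d₀ p₀ θ R hLb hd₀ hp₀ hθ hθ8 hFM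
  refine ⟨max R R₀, lt_max_of_lt_left hR, fun ε hε => ?_, hpin (max R R₀) (le_max_right R R₀)⟩
  filter_upwards [hA ε hε] with k hk
  intro S hS
  exact hk S ((le_max_left R R₀).trans hS)

/-- **The tuned strip witness implies the crux.** `NegativeCellsDilute` follows from ONE admissible regularisation
carrying the windowed strip law (a⁺), the block floor and the ratio mixing (hypothesis `h₄`, the statement of the
line's open stub `stub_tunedStripWitness`): compose `pinnedStripLaw_of_tunedStripWitness` with the certified
reduction `negativeCellsDilute_of_pinnedStripLaw` (reverse-Wegner sojourn + counting, landed wave-1 stubs). -/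
theorem negativeCellsDilute_of_tunedStripWitness
    (h₄ : ∀ Nf : ℕ, (Nf = 2 ∨ Nf = 3) → ∃ reg : QCDRegularisation Nf, reg.HasMassScaling ∧
        (reg.scheme 0 0 0).HasAsymptoticScaling ∧ ∃ M₀ : ℝ, 0 ≤ M₀ ∧ ∃ b₀ : ℕ, 2 ≤ b₀ ∧ ∃ ℓ : ℝ, 0 < ℓ ∧
        ∀ m : Fin Nf → ℝ, (∀ f, M₀ < m f) → ∃ R : ℝ, 0 < R ∧
        ∃ Lb d₀ p₀ θ : ℝ, 0 < Lb ∧ 0 < d₀ ∧ 0 < p₀ ∧ 0 ≤ θ ∧ θ ≤ 1 / 8 ∧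
        (∀ ε : ℝ, 0 < ε → ∀ᶠ k : ℕ in Filter.atTop, ∀ S : ℕ, R ≤ reg.a k * (2 * S + 1) →
          ∃ η : ℝ, 0 < η ∧ ∃ δ : ℕ → ℝ, (∀ j, 0 ≤ δ j) ∧
            ∑ j ∈ Finset.range (Nat.log 2 (⌊ℓ / reg.a k⌋₊ / b₀) + 1), δ j ≤ ε ∧
            ∀ j < Nat.log 2 (⌊ℓ / reg.a k⌋₊ / b₀) + 1, ∀ s : Fin 4 → ℕ,
              (∀ i, b₀ * 2 ^ j ≤ s i ∧ s i < b₀ * 2 ^ (j + 2) ∧ s i ≤ 2 * S + 1 ∧ (s i : ℝ) * reg.a k ≤ ℓ) →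
              η⁻¹ * ∑ f, (∫⁻ μ' in Set.Icc (reg.mcrit k + reg.a k * m f / reg.Zm k) (η - ∑ i, (1 - Real.cos (Real.pi / s i))),
                ENNReal.ofReal
                  ((∫ U : GaugeConfig 4 (2 * S + 1) (Matrix.specialUnitaryGroup (Fin 3) ℂ), (if ((∃ v : {p // wilsonBox (0 : TorusSite 4 (2 * S + 1)) s p} → ℂ, v ≠ 0 ∧
                        ∑ p, ‖(wilsonCell U μ' 0 s).mulVec v p‖ ^ 2 < η ^ 2 * ∑ p, ‖v p‖ ^ 2) ∨
                      ∃ c : Fin 4 → Bool, ∃ v : {p // wilsonBox (halfCorner s c : TorusSite 4 (2 * S + 1)) (halfSides s c) p} → ℂ,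
                        v ≠ 0 ∧ ∑ p, ‖(wilsonCell U μ' (halfCorner s c) (halfSides s c)).mulVec v p‖ ^ 2 <
                          η ^ 2 * ∑ p, ‖v p‖ ^ 2) then (1 : ℝ) else 0) *
                        ∏ f, ‖fermionDet (wilsonDirac (fundamentalRep (Fin 3)) U (reg.mcrit k + reg.a k * m f / reg.Zm k) 1)‖ ∂(wilsonMeasure (fundamentalRep (Fin 3)) (reg.β k))) /
                    (∫ U : GaugeConfig 4 (2 * S + 1) (Matrix.specialUnitaryGroup (Fin 3) ℂ),
                        ∏ f, ‖fermionDet (wilsonDirac (fundamentalRep (Fin 3)) U (reg.mcrit k + reg.a k * m f / reg.Zm k) 1)‖ ∂(wilsonMeasure (fundamentalRep (Fin 3)) (reg.β k))))).toReal ≤ δ j) ∧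
        (∀ M : ℝ, M₀ < M → ∀ᶠ k : ℕ in Filter.atTop, ∀ S : ℕ, R ≤ reg.a k * (2 * S + 1) →
          let N : ℕ := 2 * S + 1
          let mq : Fin Nf → ℝ := fun f => reg.mcrit k + reg.a k * m f / reg.Zm k
          let μp : ℝ := reg.mcrit k - reg.a k * M / reg.Zm k
          let n : ℕ := ⌈Lb / reg.a k⌉₊
          let g : ℕ := ⌈d₀ / reg.a k⌉₊
          let σ : GaugeConfig 4 N SU3 → ℝ := fun U =>
            if (fermionDet (wilsonDirac (fundamentalRep (Fin 3)) U μp 1)).re < 0 then -1 else 1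
          let w : GaugeConfig 4 N SU3 → ℝ := fun U =>
            Real.exp (-(reg.β k * wilsonAction (fundamentalRep (Fin 3)) U)) *
              ∏ f, ‖fermionDet (wilsonDirac (fundamentalRep (Fin 3)) U (mq f) 1)‖
          let blk : TorusSite 4 N → Finset (Edge 4 N) := fun x =>
            Finset.univ.filter fun e => ∀ i, (e.1 i - x i).val < n
          let r : Finset (Edge 4 N) → GaugeConfig 4 N SU3 → GaugeConfig 4 N SU3 → GaugeConfig 4 N SU3 :=
            fun B U V e => if e ∈ B then V e else U e
          let mb : TorusSite 4 N → GaugeConfig 4 N SU3 → ℝ := fun x U =>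
            (∫ V, (if σ (r (blk x) U V) ≠ σ U then (1 : ℝ) else 0) * w (r (blk x) U V)
                ∂(Measure.pi fun _ : Edge 4 N => haarProbability SU3)) /
              (∫ V, w (r (blk x) U V) ∂(Measure.pi fun _ : Edge 4 N => haarProbability SU3))
          (∀ x : TorusSite 4 N, p₀ ≤ qcdPhaseQuenchedExpect (reg.β k) N mq (mb x)) ∧
          (∀ x x' : TorusSite 4 N,
            (∃ i : Fin 4, ∀ t t' : ℕ, t < n → t' < n →
              g ≤ ((x i + (t : ZMod N)) - (x' i + (t' : ZMod N))).val ∧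
                g ≤ ((x' i + (t' : ZMod N)) - (x i + (t : ZMod N))).val) →
            qcdPhaseQuenchedExpect (reg.β k) N mq (fun U => mb x U * mb x' U) -
                qcdPhaseQuenchedExpect (reg.β k) N mq (mb x) * qcdPhaseQuenchedExpect (reg.β k) N mq (mb x') ≤
              θ * (qcdPhaseQuenchedExpect (reg.β k) N mq (mb x) *
                qcdPhaseQuenchedExpect (reg.β k) N mq (mb x'))))) :
    NegativeCellsDilute :=
  negativeCellsDilute_of_pinnedStripLaw (pinnedStripLaw_of_tunedStripWitness h₄)

end Summit.QuantumFields.QCD.Cruxes.NegativeCellsDilute.MassWegnerCellIndex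

end
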